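import Summits.ResolutionOfSingularities.ResolutionOfSingularities.Theses.SeparableGalois
import Literature.AlgebraicGeometry.Resolution.GaloisAlterationsQuasiProjective

/-!
# Crux `GaloisQuotientModels` (stmt-ResolutionOfSingularities-18955) — line `inseparability-foliation-sandwich`

CRUX-PLAN SKELETON (planner-cruxplan-…-inseparability-folia-0, 2026-08-17), built from the crux idea card
`Cruxes/GaloisQuotientModels/Ideas/inseparability-foliation-sandwich.md` MERGED (as all three triagers asked,
TRIAGE-r1-1/2/3) with its sibling `inseparability-foliation-quotient.md`: the target class of the foliation step is
LOG-CANONICAL (non-singular OR multiplicative), never the dead "Smooth Sandwich" strong form (nodal hyperelliptic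
specimen, residues `(0, −½, −1)`, blow-up dynamics cycle for `p ≥ 5`).

W = `SeparableGalois.GaloisQuotientModels`: over a PERFECT field `k` of characteristic `p`, every integral separated
finite-type `X/k` has a proper BIRATIONAL `π : X₁ → X` with `X₁ = X'/G` a Galois-type quotient of a REGULAR `X'`.

## The line (five registered stubs; composition `GaloisQuotientModels_of` is a sorry-free strong induction)

Keep de Jong's Galois alteration as a black box and DIVIDE OUT its purely inseparable defect one Frobenius
sandwich at a time.  Throughout, a MODEL of `X` is `(Y, ρ : G →* Aut Y, ψ : Y → X)`: `Y` integral REGULAR,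
`ψ` a `G`-invariant alteration, `G` faithful, finite subsets of `Y` in affine opens (quasi-projectivity, as the
named fact renders it), and (d) `K(X) ⊆ K(Y)^G` purely inseparable — all on function fields through the tree's
`RatFn.functionFieldMap`.  Measure `m(Y) := [K(Y) : ψ♯K(X)]` (`Module.finrank` over the subfield `ψ♯K(X)`).

* A  `stub_deJongGaloisAlteration` — de Jong 1997 Thm 5.13/Cor 5.15 (p.i. Galois alteration with regular
     quasi-projective top and faithful group), i.e. the named fact
     `Literature.AlgebraicGeometry.Resolution.DeJong1997_galoisAlterationQuasiProjective.{0}` in characteristic `p`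
     (its `ringExpChar K(X)` replaced by `p`).  KNOWN in print, XL to formalise; dischargeable in ten lines
     CONDITIONALLY on the named fact (as `Theorems/WildQuotientsGaloisQuotientAlteration.lean` does for stmt-16323).
* B0 `stub_sandwichDerivation` — the FIELD step (card `stub_sandwich`, LANDED p143429, + Artin + an index-`p` step of
     a finite purely inseparable extension + height-one derivations): if `K(Y)^G ≠ K(X)` there is a nonzero
     `p`-closed derivation `D` of `K(Y)` killing `K(X)` whose kernel (`= K₂·K(Y)^p`, the Frobenius sandwich of an
     index-`p` step `K(X)K₁^p ⊆ K₂ ⊂ K₁ = K(Y)^G`) is `G`-stable — the rank-ONE inseparability foliation.  Provable now (M).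
* B1 `stub_equivariantFoliationReduction` — EqFolRed, THE HARDEST STUB: a `G`-equivariant proper birational regular
     model `b : Y' → Y` on which the transform `D'` of `D` (same kernel through `b♯`) is LOG-CANONICAL at every
     point: after rescaling by a nonzero rational function it preserves the local ring and is NON-SINGULAR (some value
     a unit) or MULTIPLICATIVE (`(gD')^p = u·(gD')`, `u` a unit) — the rendering of route FoliationDescent's `FolLU`,
     made global and equivariant.  Theorem in dimension ≤ 3 (Posva arXiv:2405.05735 Thm 1, functorial in dim 2),
     open from dimension 4 (char-0 twin: McQuillan–Panazzolo).
* B2 `stub_logCanonicalQuotientModel` — TorQuot: the infinitesimal quotient `Y/F` (`F = ker D` log-canonical) is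
     regular at non-singular points (tree: `Theorems.stub_constantQuotientRegular`, `Literature…RegularDerivationQuotient`)
     and μ_p-toric at multiplicative ones (Rudakov–Shafarevich; Posva arXiv:2311.16694 Prop 11–12), and admits a
     REGULAR `G`-model `Y''` proper over `X` with finite subsets in affine opens — typed through a `G`-equivariant
     `K(X)`-embedding `ι : K(Y'') → K(Y)` onto `ker D`; the measure drops (`[K(Y) : ker D] = p`).  Size L; triage
     caveat (r1-1): equivariance of the toroidal resolution needs the CENTRALISER of the residues, not mere canonicity.
* C  `stub_separableQuotientModel` — terminal step: a model with `K(Y)^G = K(X)` yields W's ∃-block verbatim: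
     `X₁ := Y/G` (tree `Literature.AlgebraicGeometry.RelativeSpec.FiniteGroupQuotient*`, orbits in affine opens),
     `q : Y → Y/G` finite surjective `G`-invariant with orbits as fibres and étale over a dense open
     (`…FiniteGroupQuotientGenericEtale`, faithfulness), `Y/G → X` proper and BIRATIONAL because
     `K(Y/G) = K(Y)^G = K(X)` (degree-one alteration ⇒ birational, cf. `isBirational_of_surjective_stalkMap`).  Size M/L.

`GaloisQuotientModels_of`: de Jong's model (A); strong induction on `m(Y)`: either `K(Y)^G = K(X)` (C closes) or
B0 → B1 → B2 produce a model with smaller `m`; the group `G` never changes (the sandwich `L₂/K₂` is Galois with the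
SAME group — card, Lever).  Glue is pure logic: every field-theoretic fact rides inside a stub's statement.

Disproof used (Cruxes/GaloisQuotientModels/Disproof.lean, cdisprove cycle 1; Negative/LoadBearing.lean p143671):
`galoisQuotientModels_false_without_isIntegral` / `_false_without_locallyOfFiniteType` — every geometric stub keeps
`[IsIntegral X]` and `[LocallyOfFiniteType f]` (finite type enters B1/B2 through blow-ups and Noetherian normalisation,
C through E. Noether finiteness of `Y → Y/G`); §B `hasResolution_of_etale_presentation` — the content sits in the
ramification of `q`, untouched here (no stub claims `q` étale); `conclusionWithoutRegular_trivial` — regularity of the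
top is carried by B1/B2, never assumed of a quotient; PerfectField is for the MECHANISM (B1/B2 only).
-/

noncomputable section

set_option linter.dupNamespace false

open CategoryTheory AlgebraicGeometry TopologicalSpace
open Literature.AlgebraicGeometry.Resolution
open Literature.AlgebraicGeometry.Motives Literature.AlgebraicGeometry.Motives.RatFn

namespace Summit.ResolutionOfSingularities.ResolutionOfSingularities.Cruxes.GaloisQuotientModels.InseparabilityFoliationSandwich

/-! ## The registered stubs -/

/-- STUB A (input — de Jong's purely inseparable Galois alteration, de Jong 1997 Thm 5.13 / Cor 5.15, de Jong 1996
Thm 7.3, Abramovich–Oort 2000 Thm 2.8; = the named fact `DeJong1997_galoisAlterationQuasiProjective.{0}` read in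
characteristic `p`): for every field `k` of characteristic `p` and every integral separated `k`-scheme `X` of finite
type there are a finite group `G`, an integral REGULAR scheme `Y` with a FAITHFUL action `ρ : G →* Aut Y`, and a
`G`-invariant alteration `ψ : Y → X` such that every finite set of points of `Y` lies in an affine open
(quasi-projectivity) and every `G`-invariant rational function on `Y` has a `pⁿ`-th power coming from `K(X)`
(`K(X) ⊆ K(Y)^G` purely inseparable).  KNOWN; XL to formalise; conditional discharge from the named fact is ten lines
(`ringExpChar K(X) = p`). [cite: DeJong1997, Thm. 5.13, Cor. 5.15] -/
theorem stub_deJongGaloisAlteration : ∀ (p : ℕ) [Fact p.Prime] (k : Type) [Field k] [CharP k p] (X : Scheme.{0}) [IsIntegral X] (f : X ⟶ Spec (.of k)), IsSeparated f → LocallyOfFiniteType f → QuasiCompact f → ∃ (G : Type) (_ : Group G) (_ : Finite G) (Y : Scheme.{0}) (_ : IsIntegral Y) (ρ : G →* Aut Y) (ψ : Y ⟶ X) (_ : IsDominant ψ), IsAlteration ψ ∧ Scheme.IsRegular Y ∧ Function.Injective ρ ∧ (∀ g : G, (ρ g).hom ≫ ψ = ψ) ∧ (∀ S : Finset Y, ∃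 U : Y.Opens, IsAffineOpen U ∧ (↑S : Set Y) ⊆ U) ∧ (∀ a : Y.functionField, (∀ g : G, functionFieldMap (ρ g).hom a = a) → ∃ n : ℕ, a ^ p ^ n ∈ Set.range (functionFieldMap ψ)) := by
  sorry

/-- How STUB A closes (CONDITIONALLY, like stmt-16323): it is the named fact
`DeJong1997_galoisAlterationQuasiProjective.{0}` with `ringExpChar K(X) = p` (`K(X)` receives `k`). Sorry-free;
not a stub. [cite: DeJong1997, Thm. 5.13, Cor. 5.15] -/
theorem stub_deJongGaloisAlteration_of_namedFact (hdJ : DeJong1997_galoisAlterationQuasiProjective.{0}) : ∀ (p : ℕ) [Fact p.Prime] (k : Type) [Field k] [CharP k p] (X : Scheme.{0}) [IsIntegral X] (f : X ⟶ Spec (.of k)), IsSeparated f → LocallyOfFiniteType f → QuasiCompact f → ∃ (G : Type) (_ : Group G) (_ : Finite G) (Y : Scheme.{0}) (_ : IsIntegral Y) (ρ : G →* Aut Y) (ψ : Y ⟶ X) (_ : IsDominant ψ), IsAlteration ψ ∧ Scheme.IsRegular Y ∧ Function.Injective ρ ∧ (∀ g : G, (ρ g).hom ≫ ψ = ψ)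 ∧ (∀ S : Finset Y, ∃ U : Y.Opens, IsAffineOpen U ∧ (↑S : Set Y) ⊆ U) ∧ (∀ a : Y.functionField, (∀ g : G, functionFieldMap (ρ g).hom a = a) → ∃ n : ℕ, a ^ p ^ n ∈ Set.range (functionFieldMap ψ)) := by
  intro p _ k _ _ X _ f hs hl hq
  obtain ⟨G, _, _, Y, _, ρ, ψ, _, halt, hreg, hinj, hinv, haff, hd⟩ := hdJ k X f hs hl hq
  haveI : CharP X.functionField p := by
    haveI : Nonempty (⊤ : X.Opens) := ⟨⟨genericPoint X, trivial⟩⟩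
    exact (((X.germToFunctionField ⊤).hom.comp
      ((f.appTop).hom.comp (Scheme.ΓSpecIso (.of k)).inv.hom)).charP_iff_charP p).mp inferInstance
  haveI : ExpChar X.functionField p := ExpChar.prime Fact.out
  refine ⟨G, inferInstance, inferInstance, Y, inferInstance, ρ, ψ, inferInstance, halt, hreg, hinj, hinv, haff,
    fun a ha => ?_⟩
  obtain ⟨n, hn⟩ := hd a ha
  exact ⟨n, by rwa [ringExpChar.eq X.functionField p] at hn⟩

/-- STUB B0 (the Frobenius-sandwich / field step; provable now — card first lemma `stub_sandwich` LANDED as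
`Theorems.GaloisQuotientModels.InseparabilityFoliation.stub_sandwich`, p143429): let `(Y, ρ, ψ)` be a `G`-invariant
alteration of `X` with faithful `G` and `K(X) ⊆ K₁ := K(Y)^G` purely inseparable, and suppose `K₁ ≠ K(X)`.  Then
there is a NONZERO `p`-CLOSED derivation `D` of `L = K(Y)` which kills `K(X)` and whose kernel is `G`-STABLE.
(Proof sketch: `K₁/K(X)` is finite purely inseparable and non-trivial, so an index-`p` intermediate field
`K(X)·K₁^p ⊆ K₂ ⊊ K₁` exists; the sandwich `L₂ := K₂·L^p` is `G`-stable with `L₂ ∩ K₁ = K₂` (stub_sandwich) and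
`[L : L₂] = [K₁ : K₂] = p` by Artin (`G` acts faithfully on `L₂ ⊇ L^p`); take `D` a generator of `Der_{L₂}(L)`,
`ker D = L₂`; `D^p ∈ L·D` because `ker D^p ⊇ ker D` has index `p`.) The rank-ONE inseparability foliation. [folklore] -/
theorem stub_sandwichDerivation : ∀ (p : ℕ) [Fact p.Prime] (k : Type) [Field k] [CharP k p] (X : Scheme.{0}) [IsIntegral X] (f : X ⟶ Spec (.of k)) [IsSeparated f] [LocallyOfFiniteType f] [QuasiCompact f] (G : Type) [Group G] [Finite G] (Y : Scheme.{0}) [IsIntegral Y] (ρ : G →* Aut Y) (ψ : Y ⟶ X) [IsDominant ψ], IsAlteration ψ → Function.Injective ρ → (∀ g : G, (ρ g).hom ≫ ψ = ψ) → (∀ a : Y.functionField, (∀ g : G, functionFieldMap (ρ g).hom a = a) → ∃ n : ℕ, a ^ p ^ n ∈ Set.range (functionFieldMap ψ)) → ¬ (∀ a : Y.functionField, (∀ g : G, functionFieldMap (ρ g).hom a = a) → a ∈ Set.range (functionFieldMap ψ)) → ∃ D : Derivation ℤ Y.functionField Y.functionField, D ≠ 0 ∧ (∃ c : Y.functionField,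 ∀ a : Y.functionField, (⇑D)^[p] a = c * D a) ∧ (∀ (g : G) (a : Y.functionField), D a = 0 → D (functionFieldMap (ρ g).hom a) = 0) ∧ (∀ c : X.functionField, D (functionFieldMap ψ c) = 0) := by
  sorry

/-- STUB B1 (EqFolRed — THE HARDEST STUB; equivariant log-canonical reduction of a rank-one `p`-closed foliation on a
regular variety over a perfect field): in the situation of B0 (model `(Y, ρ, ψ)` of `X`: `Y` regular, `G` faithful,
finite subsets in affine opens, (d); `D ≠ 0` a `p`-closed derivation of `K(Y)` killing `K(X)` with `G`-stable kernel)
there are a `G`-EQUIVARIANT PROPER BIRATIONAL `b : Y' → Y` with `Y'` again such a model of `X` (through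
`ψ' = b ≫ ψ`) and a derivation `D'` of `K(Y')` with THE SAME KERNEL (`D a = 0 ↔ D' (b♯ a) = 0`: the transform of
the foliation), nonzero, `p`-closed, killing `K(X)`, `G`-stable kernel, which is LOG-CANONICAL AT EVERY POINT `y`
of `Y'`: for some rational function `g ≠ 0`, `g·D'` maps `𝒪_{Y',y}` into itself and is NON-SINGULAR there (some
value is a unit) or MULTIPLICATIVE (`(g·D')^p = u·(g·D')` with `u` a unit at `y`) — the rendering of
FoliationDescent's `FolLU`, global and equivariant; the measure `[K(Y') : K(X)] = [K(Y) : K(X)]` is unchanged.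
Theorem in dimension ≤ 3 (Posva 2024 Thm 1; dim 2 functorial: Thm 4, Rudakov–Shafarevich 1976), OPEN from
dimension 4; expected mechanism: blow up regular `G`-stable `D`-invariant centres in `Sing(D)`, counter
(ord D, Jordan type of the nilpotent linear part, ord λ in `D^p = λD`), additive → multiplicative by Hochschild's
formula. [cite: arXiv:2405.05735, Thm. 1 and Thm. 4.0.1] -/
theorem stub_equivariantFoliationReduction : ∀ (p : ℕ) [Fact p.Prime] (k : Type) [Field k] [CharP k p] [PerfectField k] (X : Scheme.{0}) [IsIntegral X] (f : X ⟶ Spec (.of k)) [IsSeparated f] [LocallyOfFiniteType f] [QuasiCompact f] (G : Type) [Group G] [Finite G] (Y : Scheme.{0}) [IsIntegral Y] (ρ : G →* Aut Y) (ψ : Y ⟶ X) [IsDominant ψ], IsAlteration ψ → Scheme.IsRegular Y → Function.Injective ρ → (∀ g : G, (ρ g).hom ≫ ψ = ψ) → (∀ S : Finset Y, ∃ U : Y.Opens, IsAffineOpen U ∧ (↑S : Set Y) ⊆ U) → (∀ a : Y.functionField, (∀ g : G, functionFieldMap (ρ g).hom a = a) → ∃ n : ℕ, a ^ p ^ n ∈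 Set.range (functionFieldMap ψ)) → ∀ (D : Derivation ℤ Y.functionField Y.functionField), D ≠ 0 → (∃ c : Y.functionField, ∀ a : Y.functionField, (⇑D)^[p] a = c * D a) → (∀ (g : G) (a : Y.functionField), D a = 0 → D (functionFieldMap (ρ g).hom a) = 0) → (∀ c : X.functionField, D (functionFieldMap ψ c) = 0) → ∃ (Y' : Scheme.{0}) (_ : IsIntegral Y') (ρ' : G →* Aut Y') (ψ' : Y' ⟶ X) (_ : IsDominant ψ') (b : Y' ⟶ Y) (_ : IsDominant b) (D' : Derivation ℤ Y'.functionField Y'.functionField), IsProper b ∧ IsBirational b ∧ b ≫ ψ = ψ' ∧ (∀ g : G, (ρ' g).hom ≫ b = b ≫ (ρ g).hom) ∧ (∀ a : Y.functionField, D a = 0 ↔ D' (functionFieldMap b a) = 0) ∧ IsAlteration ψ' ∧ Scheme.IsRegular Y' ∧ Function.Injective ρ' ∧ (∀ g : G, (ρ' g).hom ≫ ψ' = ψ') ∧ (∀ S : Finset Y', ∃ U : Y'.Opens, IsAffineOpen U ∧ (↑S : Set Y') ⊆ U) ∧ (∀ a : Y'.functionField, (∀ g : G, functionFieldMap (ρ'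 g).hom a = a) → ∃ n : ℕ, a ^ p ^ n ∈ Set.range (functionFieldMap ψ')) ∧ D' ≠ 0 ∧ (∃ c : Y'.functionField, ∀ a : Y'.functionField, (⇑D')^[p] a = c * D' a) ∧ (∀ (g : G) (a : Y'.functionField), D' a = 0 → D' (functionFieldMap (ρ' g).hom a) = 0) ∧ (∀ c : X.functionField, D' (functionFieldMap ψ' c) = 0) ∧ (∀ y : Y', ∃ g : Y'.functionField, g ≠ 0 ∧ (∀ h : Y'.functionField, IsRegularAt y h → IsRegularAt y (g * D' h)) ∧ ((∃ h : Y'.functionField, IsRegularAt y h ∧ IsUnitAt y (g * D' h)) ∨ (∃ u : Y'.functionField, IsUnitAt y u ∧ ∀ h : Y'.functionField, (fun x => g * D' x)^[p] h = u * (g * D' h)))) ∧ Module.finrank (functionFieldMap ψ').fieldRange Y'.functionField = Module.finrank (functionFieldMap ψ).fieldRange Y.functionField := by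
  sorry

/-- STUB B2 (TorQuot — quotient by a log-canonical `p`-closed line field and its equivariant toroidal resolution):
for a model `(Y, ρ, ψ)` of `X` over a PERFECT field (`Y` regular, `G` faithful, finite subsets in affine opens, (d))
and a nonzero `p`-closed derivation `D` of `K(Y)` killing `K(X)` with `G`-stable kernel which is log-canonical at
every point of `Y` (B1's output), there is a model `(Y'', ρ'', ψ'')` of `X` whose function field is `ker D`,
`G`-EQUIVARIANTLY OVER `K(X)`: a ring embedding `ι : K(Y'') → K(Y)` with image `ker D`, `ι ∘ ψ''♯ = ψ♯` and
`ι ∘ (ρ'' g)♯ = (ρ g)♯ ∘ ι`; and the measure drops, `[K(Y'') : K(X)] < [K(Y) : K(X)]` (indeed `[K(Y) : ker D] = p`).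
Mechanism: the infinitesimal quotient `Y → Y/F` (`𝒪_{Y/F} = 𝒪_Y ∩ ker D`, finite over the Frobenius twist, `G`
acts since `ker D` is `G`-stable, maps to `X` since `D` kills `K(X)`) is REGULAR at non-singular points (constants of
a `p`-nilpotent derivation with a unit value: tree `Theorems.stub_constantQuotientRegular`,
`Literature…RegularDerivationQuotient`) and a μ_p-TORIC quotient singularity at multiplicative points
(Rudakov–Shafarevich 1976 Thm 2; Posva arXiv:2311.16694 Prop 11–12 / Thm 7); resolve torically and
`G`-equivariantly (KKMS / Kato 1994 log-regular resolution, tree named fact `Kato1994_logRegular_hasResolution`;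
TRIAGE r1-1 caveat: a `p`-group may act wildly INSIDE an eigenspace of a multiplicative point, so the resolution must
be functorial for the whole centraliser of the residue data, not merely canonical), keeping quasi-projectivity.
[cite: arXiv:2311.16694, Prop. 11–12 and Thm. 7] -/
theorem stub_logCanonicalQuotientModel : ∀ (p : ℕ) [Fact p.Prime] (k : Type) [Field k] [CharP k p] [PerfectField k] (X : Scheme.{0}) [IsIntegral X] (f : X ⟶ Spec (.of k)) [IsSeparated f] [LocallyOfFiniteType f] [QuasiCompact f] (G : Type) [Group G] [Finite G] (Y : Scheme.{0}) [IsIntegral Y] (ρ : G →* Aut Y) (ψ : Y ⟶ X) [IsDominant ψ], IsAlteration ψ → Scheme.IsRegular Y → Function.Injective ρ → (∀ g : G, (ρ g).hom ≫ ψ = ψ) → (∀ S : Finset Y, ∃ U : Y.Opens, IsAffineOpen U ∧ (↑S : Set Y) ⊆ U) → (∀ a : Y.functionField, (∀ g : G, functionFieldMap (ρ g).hom a = a) → ∃ n : ℕ, a ^ p ^ n ∈ Set.range (functionFieldMap ψ)) → ∀ (D : Derivation ℤ Y.functionField Y.functionField), D ≠ 0 → (∃ c : Y.functionField, ∀ a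 : Y.functionField, (⇑D)^[p] a = c * D a) → (∀ (g : G) (a : Y.functionField), D a = 0 → D (functionFieldMap (ρ g).hom a) = 0) → (∀ c : X.functionField, D (functionFieldMap ψ c) = 0) → (∀ y : Y, ∃ g : Y.functionField, g ≠ 0 ∧ (∀ h : Y.functionField, IsRegularAt y h → IsRegularAt y (g * D h)) ∧ ((∃ h : Y.functionField, IsRegularAt y h ∧ IsUnitAt y (g * D h)) ∨ (∃ u : Y.functionField, IsUnitAt y u ∧ ∀ h : Y.functionField, (fun x => g * D x)^[p] h = u * (g * D h)))) → ∃ (Y'' : Scheme.{0}) (_ : IsIntegral Y'') (ρ'' : G →* Aut Y'') (ψ'' : Y'' ⟶ X) (_ : IsDominant ψ'') (ι : Y''.functionField →+* Y.functionField), (∀ a : Y.functionField, D a = 0 ↔ a ∈ Set.range ι) ∧ (∀ c : X.functionField, ι (functionFieldMap ψ'' c) = functionFieldMap ψ c) ∧ (∀ (g : G) (a : Y''.functionField), ι (functionFieldMap (ρ'' g).hom a) = functionFieldMap (ρ g).hom (ι a)) ∧ IsAlteration ψ'' ∧ Scheme.IsRegular Y'' ∧ Function.Injective ρ'' ∧ (∀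 g : G, (ρ'' g).hom ≫ ψ'' = ψ'') ∧ (∀ S : Finset Y'', ∃ U : Y''.Opens, IsAffineOpen U ∧ (↑S : Set Y'') ⊆ U) ∧ (∀ a : Y''.functionField, (∀ g : G, functionFieldMap (ρ'' g).hom a = a) → ∃ n : ℕ, a ^ p ^ n ∈ Set.range (functionFieldMap ψ'')) ∧ Module.finrank (functionFieldMap ψ'').fieldRange Y''.functionField < Module.finrank (functionFieldMap ψ).fieldRange Y.functionField := by
  sorry

/-- STUB C (terminal step — the SEPARABLE Galois-quotient model; SGA 1 V.1 quotient by a finite group, all glue in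
tree): if a model `(Y, ρ, ψ)` of `X` (regular `Y`, faithful `G`, finite subsets in affine opens, `G`-invariant
alteration `ψ`) has `K(Y)^G = K(X)` — every `G`-invariant rational function on `Y` comes from `X` — then `X` has a
birational Galois-quotient model in the sense of W: `X₁ := Y/G` (glued quotient over `Spec k`,
`Literature.AlgebraicGeometry.RelativeSpec.FiniteGroupQuotientGluing`, exists because every orbit lies in an affine
open), `q : Y → Y/G` finite surjective `G`-invariant with fibres the orbits
(`Algebra.IsInvariant.exists_smul_of_under_eq`) and étale over a dense open (`…FiniteGroupQuotientGenericEtale`,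
faithfulness of `G` on `K(Y)`), `Y/G` integral, `Y/G → X` proper (descends `ψ`) and BIRATIONAL since
`K(Y/G) = K(Y)^G = K(X)` (fraction field of invariants = invariants of the fraction field; an alteration inducing an
isomorphism of function fields is an isomorphism over a dense open, cf. tree
`Theorems.isBirational_of_surjective_stalkMap` over the finite locus). [cite: SGA1, Exp. V, Prop. 1.8 and Cor. 2.4] -/
theorem stub_separableQuotientModel : ∀ (p : ℕ) [Fact p.Prime] (k : Type) [Field k] [CharP k p] (X : Scheme.{0}) [IsIntegral X] (f : X ⟶ Spec (.of k)) [IsSeparated f] [LocallyOfFiniteType f] [QuasiCompact f] (G : Type) [Group G] [Finite G] (Y : Scheme.{0}) [IsIntegral Y] (ρ : G →* Aut Y) (ψ : Y ⟶ X) [IsDominant ψ], IsAlteration ψ → Scheme.IsRegular Y → Function.Injective ρ → (∀ g : G, (ρ g).hom ≫ ψ = ψ) → (∀ S : Finset Y, ∃ U : Y.Opens, IsAffineOpen U ∧ (↑S : Set Y) ⊆ U) → (∀ a : Y.functionField, (∀ g : G, functionFieldMap (ρ g).hom a = a) → a ∈ Set.range (functionFieldMap ψ)) → ∃ (X₁ X'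 : Scheme.{0}) (π : X₁ ⟶ X) (q : X' ⟶ X₁) (G' : Type) (_ : Group G') (_ : Finite G') (ρ' : G' →* Aut X'), IsProper π ∧ IsBirational π ∧ IsIntegral X₁ ∧ IsIntegral X' ∧ Scheme.IsRegular X' ∧ IsFinite q ∧ Function.Surjective q.base ∧ (∃ U : X₁.Opens, Dense (U : Set X₁) ∧ Etale (q ∣_ U)) ∧ (∀ g : G', (ρ' g).hom ≫ q = q) ∧ (∀ x y : X', q.base x = q.base y → ∃ g : G', (ρ' g).hom.base x = y) := by
  sorry

/-! ## Composition: the line closes the crux modulo its five stubs -/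

/-- The crux `SeparableGalois.GaloisQuotientModels` (by name) from the five stubs: de Jong's model (A), then strong
induction on the degree `[K(Y) : K(X)]` of the current regular `G`-model — either all `G`-invariant rational
functions come from `X` (C yields W's witness block) or the sandwich derivation (B0), its equivariant log-canonical
reduction (B1) and the regular model of its quotient (B2) give a model of strictly smaller degree with the SAME
group. Pure logic. [folklore] -/
theorem GaloisQuotientModels_of :
    Summit.ResolutionOfSingularities.ResolutionOfSingularities.Theses.SeparableGalois.GaloisQuotientModels := by
  intro p hp k _ _ _ X f hs hl hq hX
  haveI : Fact p.Prime := ⟨hp⟩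
  haveI := hs; haveI := hl; haveI := hq; haveI := hX
  obtain ⟨G, _, _, Y₀, _, ρ₀, ψ₀, _, halt₀, hreg₀, hinj₀, hinv₀, haff₀, hd₀⟩ :=
    stub_deJongGaloisAlteration p k X f hs hl hq
  -- strong induction on the degree `[K(Y) : K(X)]` of the current model
  suffices H : ∀ (n : ℕ) (Y : Scheme.{0}) [IsIntegral Y] (ρ : G →* Aut Y) (ψ : Y ⟶ X) [IsDominant ψ],
      IsAlteration ψ → Scheme.IsRegular Y → Function.Injective ρ → (∀ g : G, (ρ g).hom ≫ ψ = ψ) →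
      (∀ S : Finset Y, ∃ U : Y.Opens, IsAffineOpen U ∧ (↑S : Set Y) ⊆ U) →
      (∀ a : Y.functionField, (∀ g : G, functionFieldMap (ρ g).hom a = a) →
        ∃ n : ℕ, a ^ p ^ n ∈ Set.range (functionFieldMap ψ)) →
      Module.finrank (functionFieldMap ψ).fieldRange Y.functionField = n →
      ∃ (X₁ X' : Scheme.{0}) (π : X₁ ⟶ X) (q : X' ⟶ X₁) (G' : Type) (_ : Group G') (_ : Finite G')
        (ρ' : G' →* Aut X'), IsProper π ∧ IsBirational π ∧ IsIntegral X₁ ∧ IsIntegral X' ∧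
        Scheme.IsRegular X' ∧ IsFinite q ∧ Function.Surjective q.base ∧
        (∃ U : X₁.Opens, Dense (U : Set X₁) ∧ Etale (q ∣_ U)) ∧ (∀ g : G', (ρ' g).hom ≫ q = q) ∧
        (∀ x y : X', q.base x = q.base y → ∃ g : G', (ρ' g).hom.base x = y) by
    exact H _ Y₀ ρ₀ ψ₀ halt₀ hreg₀ hinj₀ hinv₀ haff₀ hd₀ rfl
  intro n
  induction n using Nat.strong_induction_on with
  | _ n ih =>
    intro Y _ ρ ψ _ halt hreg hinj hinv haff hd hn
    by_cases hT : ∀ a : Y.functionField, (∀ g : G, functionFieldMap (ρ g).hom a = a) →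
        a ∈ Set.range (functionFieldMap ψ)
    · -- terminal: `K(Y)^G = K(X)`, the quotient `Y/G → X` is the birational Galois-quotient model
      exact stub_separableQuotientModel p k X f G Y ρ ψ halt hreg hinj hinv haff hT
    · -- one Frobenius sandwich: derivation, equivariant log-canonical reduction, regular quotient model
      obtain ⟨D, hD0, hDp, hDG, hDK⟩ := stub_sandwichDerivation p k X f G Y ρ ψ halt hinj hinv hd hT
      obtain ⟨Y', _, ρ', ψ', _, b, _, D', -, -, -, -, -, halt', hreg', hinj', hinv', haff', hd', hD0', hDp',
          hDG', hDK', hlog, hmeas⟩ :=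
        stub_equivariantFoliationReduction p k X f G Y ρ ψ halt hreg hinj hinv haff hd D hD0 hDp hDG hDK
      obtain ⟨Y'', _, ρ'', ψ'', _, ι, -, -, -, halt'', hreg'', hinj'', hinv'', haff'', hd'', hlt⟩ :=
        stub_logCanonicalQuotientModel p k X f G Y' ρ' ψ' halt' hreg' hinj' hinv' haff' hd' D' hD0' hDp' hDG'
          hDK' hlog
      exact ih _ (by rw [← hn, ← hmeas]; exact hlt) Y'' ρ'' ψ'' halt'' hreg'' hinj'' hinv'' haff'' hd'' rfl

end Summit.ResolutionOfSingularities.ResolutionOfSingularities.Cruxes.GaloisQuotientModels.InseparabilityFoliationSandwich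

end
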